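import Summits.CriticalPhenomena.PercolationContinuityZ3.Theorems.PercNearOneGluingNoHeavyPcintWinKernelSymCert
import Summits.CriticalPhenomena.PercolationContinuityZ3.Theorems.PercNearOneGluingNoHeavyPcintWinKernelRange
import HarnessLib

/-!
# PCINT lane, kernel B2r window certificate `d = 5`, memory 6 (5-step windows, 100000 codes) — table and chunk check

Cell `prim-pcint`, seat `prim-pcint-2` (gen 2); memo `run/shared/lean/prim/pcint/REDUCTIONS.md` §B2r, INTERVAL-PLAN §14.
Does NOT build on p205010.  Instance data for the generic theorem
`WinK.le_siteCriticalProb_of_checkSK`: `p = 1252/10^4`, `q̄ = 9853/10^4` (`q̄^9 ≥ 1-p`), `κ̄ = (10^4+9853)/(2·10^4)`; Collatz–Wielandt vector on the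
71 hyperoctahedral normal forms keyed by the Gram code of the window (integer scale `10^5`, found by power iteration and verified in exact arithmetic
off-line: max row ratio `215137770981997863931/215190000000000000000` < 1; `λ = 99999/10^5`).  The `100000` coded rows are checked (only on first-use normal forms, WinK.isNF) by `decide +kernel` in
`…KernZ5S6Check*`; result in `…KernZ5S6`: `p_c^site(ℤ⁵) ≥ 0.1252`.
-/

namespace Summit.CriticalPhenomena.PercolationContinuityZ3.Theorems.Pcint

namespace Z5S6

set_option maxRecDepth 4000 in
/-- Certificate table, chunk 1/1 (`Gram code ↦ v`). [folklore] -/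
def tbl1 : List (ℕ × ℕ) := [(282817489141, 86449), (282817489387, 86449), (282817548199, 86449), (282817668475, 86498), (282817727779, 86498), (282831838075, 86449), (282832017409, 86498), (282846187009, 86076), (282846366343, 86361), (282860542423, 86542), (282860601481, 86542), (282874891603, 86542), (282948223627, 87945), (282948223873, 87945), (282962631619, 87945), (282991456243, 87962), (283005864481, 87962), (286304273623, 86449), (286304452957, 86498), (286347326905, 86542), (286435008109, 87945), (286478240725, 87962), (289791058105, 86000), (289791237439, 86361), (289834111387, 86542), (289921792591, 87787), (289965025207, 87962), (293277862027, 86542), (293277921085, 86542), (293292210961, 86542), (293306559895, 86542), (293408596513, 87962), (293423004505, 87962), (296764646755, 86542), (296895381241, 87962), (303738234913, 76631), (303738293971, 76943), (303752583847, 76943), (303868969399, 87682), (303883377391, 87840), (310711804123, 76579), (310842538609, 87656), (314203331719, 87998), (314203331965, 87998), (314217680653, 87998), (314232029587, 87918), (314246385001, 87998), (314260734181, 87998), (317690175259, 87998), (317733228541, 87998), (324663883939, 87998), (324678232873, 87998), (324692581807, 87998), (328150727725, 87998), (378122929435, 99852), (378122929681, 99852), (378122988493, 99852), (378123108769, 99869),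 (378123168073, 99869), (381624062851, 99852), (381624242185, 99869), (385125196267, 99453), (385125375601, 99710), (388626355603, 99891), (388626414661, 99891), (392127489265, 99891), (409639506499, 100000), (409639506745, 100000), (413140698973, 100000), (420143112001, 100000), (423644304721, 100000)]


/-- The certificate table `Gram code ↦ v` (concatenation of the chunks). [folklore] -/
def tbl : List (ℕ × ℕ) := tbl1

/-- All table values lie in `[76579, 100000]`. [folklore] -/
theorem tbl_bounds : ∀ e ∈ tbl, 76579 ≤ e.2 ∧ e.2 ≤ 100000 := by decide +kernel

/-- The Collatz–Wielandt row check on the window codes `[lo, hi)`. [folklore] -/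
def chk (lo hi : ℕ) : Bool := WinK.allRange (WinK.nfOKS 5 4 1252 9853 99999 tbl 76579) lo hi

/-- Splitting a chunk check. [folklore] -/
theorem chk_split {lo mid hi : ℕ} (h1 : chk lo mid = true) (h2 : chk mid hi = true) : chk lo hi = true :=
  WinK.allRange_split h1 h2

end Z5S6

end Summit.CriticalPhenomena.PercolationContinuityZ3.Theorems.Pcint
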